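import Summits.Parity.BatemanHorn.Theses.IsogenyRedei

/-!
# Route IsogenyRedei — `PencilInvariants` (item stmt-Parity-11586)

The invariants of the 2-isogenous pencil `E_t = ⟨0, 2t, 0, t² + 1, 0⟩` over `ℚ`
(the curve `y² = x³ + 2t x² + (t² + 1) x = x((x + t)² + 1)`):

* `c₄ = 16 (t² − 3)`,
* `c₆ = 64 t (t² + 9)`,
* `Δ = −64 (t² + 1)²`.

These are polynomial identities in `ℚ[t]`: with `a₁ = a₃ = a₆ = 0`, `a₂ = 2t`, `a₄ = t² + 1`
one has `b₂ = 8t`, `b₄ = 2(t² + 1)`, `b₆ = 0`, `b₈ = −(t² + 1)²`, whence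
`c₄ = b₂² − 24 b₄`, `c₆ = −b₂³ + 36 b₂ b₄ − 216 b₆`, `Δ = −b₂² b₈ − 8 b₄³ − 27 b₆² + 9 b₂ b₄ b₆`
evaluate as stated. Proof: unfold the Weierstrass quantities and `ring`.
-/

namespace Summit.Parity.BatemanHorn.Theorems

/-- **PencilInvariants** (route IsogenyRedei, item stmt-Parity-11586): for every `t : ℚ` the
Weierstrass curve `⟨0, 2t, 0, t² + 1, 0⟩` has `c₄ = 16 (t² − 3)`, `c₆ = 64 t (t² + 9)` and
`Δ = −64 (t² + 1)²`. Pure polynomial identities (`simp only` on the `b`/`c`/`Δ` definitions,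
then `ring`). -/
theorem pencilInvariants_proof :
    Summit.Parity.BatemanHorn.Theses.IsogenyRedei.PencilInvariants := by
  unfold Summit.Parity.BatemanHorn.Theses.IsogenyRedei.PencilInvariants
  intro t
  refine ⟨?_, ?_, ?_⟩
  · simp only [WeierstrassCurve.c₄, WeierstrassCurve.b₂, WeierstrassCurve.b₄]
    ring
  · simp only [WeierstrassCurve.c₆, WeierstrassCurve.b₂, WeierstrassCurve.b₄,
      WeierstrassCurve.b₆]
    ring
  · simp only [WeierstrassCurve.Δ, WeierstrassCurve.b₂, WeierstrassCurve.b₄,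
      WeierstrassCurve.b₆, WeierstrassCurve.b₈]
    ring

end Summit.Parity.BatemanHorn.Theorems
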